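import Literature.Geometry.Riemannian.CyclicCoverMetric
import HarnessLib

/-!
# Riemannian distance on the infinite cyclic cover: distance to a fibre orbit, dense orbits

Continuation of `CyclicCoverMetric.lean` (the lifted metric `proj^* g` on the infinite cyclic
cover `X̂ = CircleMaps.CyclicCover f` of a Riemannian manifold `(X, g)` along `f : X → S¹`, on
which the deck group `ℤ` acts by isometries). For the Riemannian distances `d` of `g` and `d̂` of
`proj^* g` (`PseudoRiemannianMetric.edist`, O'Neill 1983, Ch. 5, Def. 15) we prove:

* `edist_proj_le` — **the covering projection is distance non-increasing**,
  `d(proj x̂, proj ŷ) ≤ d̂(x̂, ŷ)` (`dproj` preserves the norms of tangent vectors, so `proj` does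
  not increase the length of `C¹` curves; the tree's `riemannianEDist_comp_le`);
* `exists_lift_contMDiff_one` — **`C¹` curves of `X` lift to `C¹` curves of `X̂`** through any
  point over their start (topological lifting, Hatcher 2002, Prop. 1.30, plus smoothness of
  continuous lifts, Lee 2012, Prop. 4.40);
* `exists_edist_vadd_lt`, `iInf_edist_vadd_eq` — **the distance in the base is the distance to
  the fibre orbit in the cover**: `inf_{k ∈ ℤ} d̂(x̂, k +ᵥ p̂) = d(proj x̂, proj p̂)` (lift a short
  `C¹` curve from `proj x̂` to `proj p̂`; its lift from `x̂` has the same length, the tree's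
  `pathELength_comp_eq`, and ends in the `ℤ`-orbit of `p̂`);
* `exists_edist_vadd_lt_of_forall_lt` — consequently **the `ℤ`-orbits are `D`-dense in the cover
  of a manifold of diameter `< D`** (the cocompactness of the deck group action on the covers `M̂ᵢ`,
  `diam(Mᵢ) ≤ 1`, feeding the "standard argument" of Huang–Huang–Wang–Zhu 2026, §4, p. 13 that the
  deck group is generated by short elements, cf. the abstract
  `subgroupClosure_setOf_dist_smul_lt_eq_top` of `AlmostNonnegRicciFibrationProofs.lean`).

Everything is proved; no named facts.

## References

* B. O'Neill, *Semi-Riemannian Geometry* (1983), Ch. 5, Def. 11, Def. 15 (arc length, distance);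
  Ch. 7, pp. 191–192 (semi-Riemannian coverings). [ONeill1983]
* A. Hatcher, *Algebraic Topology* (2002), §1.3, Props. 1.30, 1.33 (lifting). [HatcherAT2002]
* J. M. Lee, *Introduction to Smooth Manifolds*, 2nd ed. (2012), Prop. 4.40. [LeeSmoothManifolds2013]
* H. Huang, X.-T. Huang, J. Wang, X. Zhu, arXiv:2605.24380 (2026), §4, p. 13. [HuangHuangWangZhu2026]
-/

noncomputable section

open scoped Manifold ContDiff Topology ENNReal
open Function Set Filter Manifold Bundle

namespace Literature.Geometry.Riemannian

open Literature.Geometry.Lorentzian Literature.Geometry.Lorentzian.PseudoRiemannianMetric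
  Literature.Geometry.Manifold Literature.Topology.FourManifolds.CircleMaps
  Literature.Topology.FourManifolds.CircleMaps.CyclicCover

variable {E : Type*} [NormedAddCommGroup E] [NormedSpace ℝ E] [FiniteDimensional ℝ E]
  {H : Type*} [TopologicalSpace H] {I : ModelWithCorners ℝ E H}
  {X : Type*} [TopologicalSpace X] [ChartedSpace H X] [IsManifold I ∞ X]
  (f : C(X, Circle)) {g : PseudoRiemannianMetric I ∞ E (TangentSpace I : X → Type _)}
  (hg : g.IsRiemannian)

/-- **The differential of the covering projection preserves the norms of tangent vectors** for
the norms of `proj^* g` and of `g` (`(proj^* g)(v, v) = g(dproj v, dproj v)`). [folklore] -/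
theorem norm_mfderiv_cyclicCover_proj (e : CyclicCover f) (v : TangentSpace I e) :
    letI := g.riemannianBundle hg
    letI := (liftMetric f g).riemannianBundle (isRiemannian_liftMetric f g hg)
    ‖mfderiv I I (proj : CyclicCover f → X) e v‖ = ‖v‖ := by
  letI := g.riemannianBundle hg
  letI := (liftMetric f g).riemannianBundle (isRiemannian_liftMetric f g hg)
  rw [g.norm_eq_sqrt hg, (liftMetric f g).norm_eq_sqrt (isRiemannian_liftMetric f g hg),
    liftMetric_apply]

/-- **The covering projection does not increase the Riemannian distance**:
`d_g(proj x̂, proj ŷ) ≤ d_{proj^* g}(x̂, ŷ)` (`proj` is `C¹` with norm-preserving differential,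
hence `1`-Lipschitz for the length distances). [cite: ONeill1983, Ch. 5, Def. 15 (p. 134)] -/
theorem edist_proj_le (x y : CyclicCover f) :
    g.edist hg (proj x) (proj y) ≤
      (liftMetric f g).edist (isRiemannian_liftMetric f g hg) x y := by
  letI := g.riemannianBundle hg
  letI := (liftMetric f g).riemannianBundle (isRiemannian_liftMetric f g hg)
  exact riemannianEDist_comp_le (contMDiff_cyclicCover_proj f (I := I) (n := 1))
    (fun e v ↦ (norm_mfderiv_cyclicCover_proj f hg e v).le) x y

omit [FiniteDimensional ℝ E] in
/-- **`C¹` curves lift to `C¹` curves**: a `C¹` curve `γ : ℝ → X` lifts through the covering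
`proj` to a `C¹` curve `Γ : ℝ → X̂` with prescribed point `e₀` over `γ t₀` (the topological lift
along the simply connected line, Hatcher 2002, Prop. 1.30/1.33, Mathlib's
`IsCoveringMap.existsUnique_continuousMap_lifts`; it is `C¹` because `proj ∘ Γ = γ` is,
`contMDiffAt_of_comp_cyclicCover_proj`). [cite: HatcherAT2002, Prop. 1.30] -/
theorem exists_lift_contMDiff_one {γ : ℝ → X} (hγ : ContMDiff 𝓘(ℝ, ℝ) I 1 γ) {t₀ : ℝ}
    {e₀ : CyclicCover f} (he : proj e₀ = γ t₀) :
    ∃ Γ : ℝ → CyclicCover f, ContMDiff 𝓘(ℝ, ℝ) I 1 Γ ∧ proj ∘ Γ = γ ∧ Γ t₀ = e₀ := by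
  obtain ⟨F, ⟨hF0, hF⟩, -⟩ := (isCoveringMap_proj (f := f)).existsUnique_continuousMap_lifts
    ⟨γ, hγ.continuous⟩ t₀ e₀ he
  refine ⟨F, fun t ↦ ?_, hF, hF0⟩
  refine contMDiffAt_of_comp_cyclicCover_proj f F.continuous.continuousAt ?_
  rw [hF]
  exact hγ.contMDiffAt

/-- **Short curves in the base lift to the cover**: if `d_g(proj x̂, proj p̂) < r` then some
deck translate `k +ᵥ p̂` of `p̂` satisfies `d_{proj^* g}(x̂, k +ᵥ p̂) < r` — lift a `C¹` curve of
length `< r` from `proj x̂` to `proj p̂` starting at `x̂`; the lift has the same length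
(`pathELength_comp_eq`, `dproj` preserving norms) and ends over `proj p̂`, i.e. in `ℤ +ᵥ p̂`.
[cite: ONeill1983, Ch. 7, pp. 191–192] -/
theorem exists_edist_vadd_lt {x p : CyclicCover f} {r : ℝ≥0∞}
    (hr : g.edist hg (proj x) (proj p) < r) :
    ∃ k : ℤ, (liftMetric f g).edist (isRiemannian_liftMetric f g hg) x (k +ᵥ p) < r := by
  letI := g.riemannianBundle hg
  letI := (liftMetric f g).riemannianBundle (isRiemannian_liftMetric f g hg)
  have hr' : riemannianEDist I (proj x) (proj p) < r := hr
  -- a short `C¹` curve in the base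
  obtain ⟨γ, hγ0, hγ1, hγ, hlen, -, -⟩ :=
    exists_lt_locally_constant_of_riemannianEDist_lt hr' zero_lt_one
  -- its lift from `x`
  obtain ⟨Γ, hΓ, hpΓ, hΓ0⟩ := exists_lift_contMDiff_one f hγ (t₀ := 0) (e₀ := x) (by rw [hγ0])
  have h1 : proj (Γ 1) = proj p := by
    have := congrFun hpΓ 1
    rw [comp_apply] at this
    rw [this, hγ1]
  obtain ⟨k, hk⟩ := exists_vadd_eq_of_proj_eq h1
  refine ⟨k, ?_⟩
  have hΓd : ∀ t ∈ Ioo (0 : ℝ) 1, MDifferentiableAt 𝓘(ℝ, ℝ) I Γ t := fun t _ ↦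
    (hΓ t).mdifferentiableAt one_ne_zero
  have hprojd : ∀ t ∈ Ioo (0 : ℝ) 1, MDifferentiableAt I I (proj : CyclicCover f → X) (Γ t) :=
    fun t _ ↦ (contMDiff_cyclicCover_proj f (I := I) (n := 1) (Γ t)).mdifferentiableAt one_ne_zero
  calc (liftMetric f g).edist (isRiemannian_liftMetric f g hg) x (k +ᵥ p)
      = riemannianEDist I x (Γ 1) := by rw [hk]; rfl
    _ ≤ pathELength I Γ 0 1 := riemannianEDist_le_pathELength hΓ.contMDiffOn hΓ0 rfl zero_le_one
    _ = pathELength I ((proj : CyclicCover f → X) ∘ Γ) 0 1 :=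
        (pathELength_comp_eq hprojd hΓd fun t _ v ↦ norm_mfderiv_cyclicCover_proj f hg _ v).symm
    _ = pathELength I γ 0 1 := by rw [hpΓ]
    _ < r := hlen

/-- **The distance in the base is the distance to the fibre orbit in the cover**:
`inf_{k ∈ ℤ} d_{proj^* g}(x̂, k +ᵥ p̂) = d_g(proj x̂, proj p̂)` (`≥`: `proj` is distance
non-increasing and `ℤ`-invariant; `≤`: `exists_edist_vadd_lt`). [cite: ONeill1983, Ch. 7, pp. 191–192] -/
theorem iInf_edist_vadd_eq (x p : CyclicCover f) :
    ⨅ k : ℤ, (liftMetric f g).edist (isRiemannian_liftMetric f g hg) x (k +ᵥ p) =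
      g.edist hg (proj x) (proj p) := by
  refine le_antisymm (le_of_forall_gt_imp_ge_of_dense fun r hr ↦ ?_) (le_iInf fun k ↦ ?_)
  · obtain ⟨k, hk⟩ := exists_edist_vadd_lt f hg hr
    exact (iInf_le _ k).trans hk.le
  · have h := edist_proj_le f hg x (k +ᵥ p)
    rwa [proj_vadd] at h

/-- **Dense orbits**: if any two points of the base are at distance `< D`, every `ℤ`-orbit of the
cover is `D`-dense for the lifted distance (every point `x̂` is within `< D` of `ℤ +ᵥ p̂`) — the
cocompactness of the deck action on the covers of Huang–Huang–Wang–Zhu 2026, §4 (`diam ≤ 1`).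
[cite: HuangHuangWangZhu2026, §4 p. 13] -/
theorem exists_edist_vadd_lt_of_forall_lt {D : ℝ≥0∞} (hD : ∀ x y : X, g.edist hg x y < D)
    (p x : CyclicCover f) :
    ∃ k : ℤ, (liftMetric f g).edist (isRiemannian_liftMetric f g hg) x (k +ᵥ p) < D :=
  exists_edist_vadd_lt f hg (hD _ _)

end Literature.Geometry.Riemannian
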